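import Summits.NavierStokesRegularity.NavierStokesRegularity.Theses.TerminalTrace
import Summits.NavierStokesRegularity.NavierStokesRegularity.Theorems.TypeICertificateLadderNoTypeIBlowupTypeIMorrey
import Literature.Analysis.FluidPDE.LocalTypeI
import Literature.Analysis.FluidPDE.CKNLocalRegularityRRSStep3
import Literature.Analysis.FluidPDE.TaoQuantitativeSupBoundTools
import Literature.Analysis.FluidPDE.ClassicalSuitableRegionEnergy
import Literature.Analysis.FluidPDE.LerayHopfSpatialGradient
import Literature.Analysis.FluidPDE.TypeIRateScaledEnergyBound
import Literature.Analysis.FluidPDE.Seregin2020CubicLowerBound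

set_option linter.dupNamespace false

/-!
# The terminal-layer exponent `β* = 1/2` (nsreg-p2 g30, ROUND-33) — part 1/2: the elementary core

`X(σ) := limsup_{λ→0} sup_{x ∈ B(x₀,ρ)} λ⁻¹ ∫_{B(x,λ)} |u(T − σλ², y)|² dy` is the local energy left at
scale `λ` a parabolic instant `σλ²` before the blow-up time.  Type I in time gives `X ≤ M₀`
(Morrey, `morrey_of_typeI`); this file proves the kill side of the dial: if `X(σ) ≤ ε √σ` can be
achieved for every `ε` (some `σ = τ² ≤ 1`), and `u(t,·)` has Lipschitz modulus `≤ C_g/(T−t)` near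
`x₀` (the gradient companion of Type I), then `√(T−t) · sup_{B(x₀,ρ)} |u(t,·)| → 0` — the solution
is locally sub-Type-I at `x₀` (`subTypeI_of_layerDecay`).  Pure real analysis: no Navier–Stokes input.
Part 2/2 (`…LayerDecay.lean`) draws the consequence for item 18385 at unit viscosity.
(Plate t34 of nsreg-p2 g30, split in two files of at most 400 lines for the gate; the declarations
are those of the plate with the local notation `E3` spelled out as `EuclideanSpace ℝ (Fin 3)`.)
-/

noncomputable section

open MeasureTheory Set Function Metric Filter Topology Literature.Analysis.FluidPDE
open scoped ENNReal NNReal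

namespace Summit.NavierStokesRegularity.NavierStokesRegularity.Theorems.TypeITraceScarL3

/-- volume of a ball in `ℝ³` through the unit ball. -/
theorem volume_ball_eq_unit (x : (EuclideanSpace ℝ (Fin 3))) {r : ℝ} (hr : 0 ≤ r) :
    volume (ball x r) = ENNReal.ofReal (r ^ 3) * volume (ball (0 : (EuclideanSpace ℝ (Fin 3))) 1) := by
  have h := Measure.addHaar_ball (volume : Measure (EuclideanSpace ℝ (Fin 3))) x hr
  rw [finrank_euclideanSpace_fin] at h
  exact h

/-- **Locally sub-Type-I from terminal-layer decay faster than `√σ`.**  Hypotheses: a one-sided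
Lipschitz bound `|u(t,x)| − |u(t,y)| ≤ C_g/(T−t) · |y − x|` for `t ∈ (T₀,T)`, `x ∈ B(x₀,ρ)`,
`y ∈ B(x₀,2ρ)` (the gradient companion of Type I), and the layer-decay hypothesis: for every `ε > 0`
some `τ ∈ (0,1]` and `l₁ > 0` with `∫_{B(x,l)} |u(T − τ²l², y)|² dy ≤ ε τ l` for all `0 < l ≤ l₁`,
`x ∈ B(x₀,ρ)` (i.e. `X(τ²) ≤ ε √(τ²)`).  Conclusion: `√(T−t) |u(t,x)| ≤ ε_g` on `B(x₀,ρ)` for `t`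
close to `T`, for every `ε_g > 0`. -/
theorem subTypeI_of_layerDecay
    {u : ℝ → (EuclideanSpace ℝ (Fin 3)) → (EuclideanSpace ℝ (Fin 3))} {T T₀ ρ Cg : ℝ} {x₀ : (EuclideanSpace ℝ (Fin 3))} (hρ : 0 < ρ) (hCg : 0 < Cg) (hT₀ : T₀ < T)
    (hlip : ∀ t ∈ Ioo T₀ T, ∀ x ∈ ball x₀ ρ, ∀ y ∈ ball x₀ (2 * ρ),
      ‖u t x‖ - ‖u t y‖ ≤ Cg / (T - t) * dist y x)
    (hlayer : ∀ ε : ℝ, 0 < ε → ∃ τ : ℝ, 0 < τ ∧ τ ≤ 1 ∧ ∃ l₁ : ℝ, 0 < l₁ ∧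
      ∀ l : ℝ, 0 < l → l ≤ l₁ → ∀ x ∈ ball x₀ ρ,
        ∫⁻ y in ball x l, ‖u (T - τ ^ 2 * l ^ 2) y‖ₑ ^ 2 ≤ ENNReal.ofReal (ε * τ * l)) :
    ∀ εg : ℝ, 0 < εg → ∃ T₁ : ℝ, T₁ < T ∧ ∀ t ∈ Ioo T₁ T, ∀ x ∈ ball x₀ ρ,
      Real.sqrt (T - t) * ‖u t x‖ ≤ εg := by
  intro εg hεg
  -- the unit-ball volume as a positive real
  set vB : ℝ := (volume (ball (0 : (EuclideanSpace ℝ (Fin 3))) 1)).toReal with hvB_def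
  have hvBpos : 0 < vB := by
    rw [hvB_def]
    exact ENNReal.toReal_pos (measure_ball_pos volume (0 : (EuclideanSpace ℝ (Fin 3))) one_pos).ne' measure_ball_lt_top.ne
  have hvB : volume (ball (0 : (EuclideanSpace ℝ (Fin 3))) 1) = ENNReal.ofReal vB := by
    rw [hvB_def, ENNReal.ofReal_toReal measure_ball_lt_top.ne]
  -- the smallness fed into the layer hypothesis
  set ε : ℝ := min (vB * εg ^ 5 / (32 * Cg ^ 3)) (vB * εg ^ 2 / 4) with hε_def
  have hε : 0 < ε := by rw [hε_def]; positivity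
  have hε₁ : ε ≤ vB * εg ^ 5 / (32 * Cg ^ 3) := min_le_left _ _
  have hε₂ : ε ≤ vB * εg ^ 2 / 4 := min_le_right _ _
  obtain ⟨τ, hτ, hτ1, l₁, hl₁, H⟩ := hlayer ε hε
  -- admissible scales: `l ≤ l₂ := min l₁ ρ`; times `T₁ := max T₀ (T − τ² l₂²)`
  set l₂ : ℝ := min l₁ ρ with hl₂_def
  have hl₂ : 0 < l₂ := lt_min hl₁ hρ
  refine ⟨max T₀ (T - τ ^ 2 * l₂ ^ 2), max_lt hT₀ (by nlinarith [mul_pos (pow_pos hτ 2) (pow_pos hl₂ 2)]), ?_⟩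
  intro t ht x hx
  obtain ⟨ht₁, htT⟩ := ht
  have htT₀ : T₀ < t := lt_of_le_of_lt (le_max_left _ _) ht₁
  have htl₂ : T - t < τ ^ 2 * l₂ ^ 2 := by linarith [le_max_right T₀ (T - τ ^ 2 * l₂ ^ 2)]
  have hTt : 0 < T - t := sub_pos.2 htT
  -- the scale `l` with `t = T − τ² l²`
  set l : ℝ := Real.sqrt (T - t) / τ with hl_def
  have hsq : Real.sqrt (T - t) = τ * l := by rw [hl_def]; field_simp
  have hl : 0 < l := div_pos (Real.sqrt_pos.2 hTt) hτ
  have htl : T - t = τ ^ 2 * l ^ 2 := by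
    have := Real.sq_sqrt hTt.le
    rw [hsq] at this; nlinarith [this]
  have ht_eq : t = T - τ ^ 2 * l ^ 2 := by linarith
  have hll₂ : l < l₂ := by
    rw [hl_def, div_lt_iff₀ hτ, Real.sqrt_lt' (mul_pos hl₂ hτ)]
    nlinarith
  have hll₁ : l ≤ l₁ := (hll₂.le.trans (min_le_left _ _))
  have hlρ : l ≤ ρ := (hll₂.le.trans (min_le_right _ _))
  -- suppose the Type-I product is large at `(t,x)`
  by_contra hbig
  rw [not_le] at hbig
  set a : ℝ := ‖u t x‖ with ha_def
  have ha0 : 0 ≤ a := norm_nonneg _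
  rw [hsq] at hbig
  -- hbig : εg < τ * l * a
  have hapos : 0 < a := by
    rcases ha0.lt_or_eq with h | h
    · exact h
    · rw [← h, mul_zero] at hbig; exact absurd hbig (not_lt.2 hεg.le)
  -- the radius on which `|u(t,·)| ≥ a/2`
  set r : ℝ := min l (a * (τ ^ 2 * l ^ 2) / (2 * Cg)) with hr_def
  have hra : 0 < a * (τ ^ 2 * l ^ 2) / (2 * Cg) := by positivity
  have hr : 0 < r := lt_min hl hra
  have hrl : r ≤ l := min_le_left _ _
  have hrr : r ≤ a * (τ ^ 2 * l ^ 2) / (2 * Cg) := min_le_right _ _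
  -- lower bound `|u(t,y)| ≥ a/2` on `B(x,r)`
  have hlow : ∀ y ∈ ball x r, a / 2 ≤ ‖u t y‖ := by
    intro y hy
    have hy2 : y ∈ ball x₀ (2 * ρ) := by
      rw [mem_ball] at hy hx ⊢
      calc dist y x₀ ≤ dist y x + dist x x₀ := dist_triangle _ _ _
        _ < r + ρ := add_lt_add hy hx
        _ ≤ 2 * ρ := by linarith [hrl.trans hlρ]
    have h1 := hlip t ⟨htT₀, htT⟩ x hx y hy2
    rw [htl] at h1
    have h2 : Cg / (τ ^ 2 * l ^ 2) * dist y x ≤ Cg / (τ ^ 2 * l ^ 2) * r :=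
      mul_le_mul_of_nonneg_left (le_of_lt (mem_ball.1 hy)) (by positivity)
    have h3 : Cg / (τ ^ 2 * l ^ 2) * r ≤ a / 2 := by
      calc Cg / (τ ^ 2 * l ^ 2) * r ≤ Cg / (τ ^ 2 * l ^ 2) * (a * (τ ^ 2 * l ^ 2) / (2 * Cg)) :=
            mul_le_mul_of_nonneg_left hrr (by positivity)
        _ = a / 2 := by field_simp
    rw [← ha_def] at h1
    linarith
  -- integrate the lower bound over `B(x,r) ⊆ B(x,l)` and compare with the layer hypothesis
  have hmeas : ∫⁻ y in ball x r, ENNReal.ofReal ((a / 2) ^ 2) ∂volume ≤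
      ∫⁻ y in ball x l, ‖u t y‖ₑ ^ 2 ∂volume := by
    calc ∫⁻ y in ball x r, ENNReal.ofReal ((a / 2) ^ 2) ∂volume
        ≤ ∫⁻ y in ball x r, ‖u t y‖ₑ ^ 2 ∂volume := by
          refine setLIntegral_mono' measurableSet_ball fun y hy => ?_
          rw [ENNReal.ofReal_pow (by positivity), ← ofReal_norm]
          gcongr
          exact hlow y hy
      _ ≤ ∫⁻ y in ball x l, ‖u t y‖ₑ ^ 2 ∂volume := lintegral_mono_set (ball_subset_ball hrl)
  rw [setLIntegral_const, volume_ball_eq_unit x hr.le, hvB, ← ENNReal.ofReal_mul (by positivity),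
    ← ENNReal.ofReal_mul (by positivity)] at hmeas
  have hup := H l hl hll₁ x hx
  rw [← ht_eq] at hup
  have hreal : (a / 2) ^ 2 * (r ^ 3 * vB) ≤ ε * τ * l :=
    (ENNReal.ofReal_le_ofReal_iff (by positivity)).1 (hmeas.trans hup)
  -- case analysis on the radius
  rcases le_total l (a * (τ ^ 2 * l ^ 2) / (2 * Cg)) with hcase | hcase
  · -- `r = l`: then `a² l² vB ≤ 4 ε τ`, so `(τ l a)² ≤ 4 ε τ³ / vB ≤ εg²`
    have hr_eq : r = l := by rw [hr_def, min_eq_left hcase]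
    rw [hr_eq] at hreal
    have h1 : a ^ 2 * l ^ 2 * vB * l ≤ 4 * ε * τ * l := by
      have e : (a / 2) ^ 2 * (l ^ 3 * vB) = a ^ 2 * l ^ 2 * vB * l / 4 := by ring
      rw [e] at hreal
      linarith
    have h2 : a ^ 2 * l ^ 2 * vB ≤ 4 * ε * τ := le_of_mul_le_mul_right h1 hl
    have hτ3 : τ ^ 3 ≤ 1 := pow_le_one₀ hτ.le hτ1
    have e5 : 4 * ε ≤ εg ^ 2 * vB := by
      have h := hε₂
      rw [le_div_iff₀ (by norm_num : (0:ℝ) < 4)] at h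
      linarith
    have h3 : (τ * l * a) ^ 2 * vB ≤ εg ^ 2 * vB :=
      calc (τ * l * a) ^ 2 * vB = τ ^ 2 * (a ^ 2 * l ^ 2 * vB) := by ring
        _ ≤ τ ^ 2 * (4 * ε * τ) := mul_le_mul_of_nonneg_left h2 (by positivity)
        _ = 4 * ε * τ ^ 3 := by ring
        _ ≤ 4 * ε * 1 := mul_le_mul_of_nonneg_left hτ3 (by positivity)
        _ ≤ εg ^ 2 * vB := by linarith
    have h4 : (τ * l * a) ^ 2 ≤ εg ^ 2 := le_of_mul_le_mul_right h3 hvBpos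
    have h5 : τ * l * a ≤ εg := le_of_pow_le_pow_left₀ two_ne_zero hεg.le h4
    linarith
  · -- `r = a τ² l² / (2 C_g)`: then `(τ l a)⁵ vB ≤ 32 C_g³ ε ≤ vB εg⁵`
    have hr_eq : r = a * (τ ^ 2 * l ^ 2) / (2 * Cg) := by rw [hr_def, min_eq_right hcase]
    rw [hr_eq] at hreal
    have hCg0 : Cg ≠ 0 := hCg.ne'
    have e : (a / 2) ^ 2 * ((a * (τ ^ 2 * l ^ 2) / (2 * Cg)) ^ 3 * vB) * (32 * Cg ^ 3) =
        (τ * l * a) ^ 5 * vB * (τ * l) := by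
      field_simp
      ring
    have h1 : (τ * l * a) ^ 5 * vB * (τ * l) ≤ 32 * Cg ^ 3 * ε * (τ * l) := by
      rw [← e]
      have := mul_le_mul_of_nonneg_right hreal (show (0:ℝ) ≤ 32 * Cg ^ 3 by positivity)
      linarith
    have h2 : (τ * l * a) ^ 5 * vB ≤ 32 * Cg ^ 3 * ε := le_of_mul_le_mul_right h1 (mul_pos hτ hl)
    have e5 : 32 * Cg ^ 3 * ε ≤ εg ^ 5 * vB := by
      have h := hε₁
      rw [le_div_iff₀ (by positivity)] at h
      linarith
    have h4 : (τ * l * a) ^ 5 ≤ εg ^ 5 := le_of_mul_le_mul_right (h2.trans e5) hvBpos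
    have h5 : τ * l * a ≤ εg := le_of_pow_le_pow_left₀ (by norm_num) hεg.le h4
    linarith

end Summit.NavierStokesRegularity.NavierStokesRegularity.Theorems.TypeITraceScarL3

end
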